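import Summits.BirchSwinnertonDyer.BirchSwinnertonDyer.Theorems.TwoAdicConverseOrdLambdaHalfAtTwoGreenbergCotorsionOfResidual
import Summits.BirchSwinnertonDyer.BirchSwinnertonDyer.Theorems.UniversalToricDescentResidualSelmerTransport
import Literature.NumberTheory.EllipticCurves.DivisionFieldRamificationDividesProofs
import HarnessLib

/-!
# Route `TwoAdicConverse` (rung S3), crux `OrdLambdaHalfAtTwo` (item stmt-BirchSwinnertonDyer-19556), line
# `kato-determinant-greenberg-two`: at `p = 2` the two characters of the reducible dévissage COINCIDE — B2 ⟸ ONE `GL(1)`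
# residual finiteness input

Cell `bsd-2adic`, seat `bsd-2adic-conv-1` GEN 24 (`--supports` stmt-BirchSwinnertonDyer-19556; helper; route-independent imports).
Companion of `TwoAdicConverseOrdLambdaHalfAtTwoGreenbergCotorsionOfResidual` (p658418: B2 ⟸ finiteness of the residual Castella
Selmer groups of `Φ` AND of `E[p]/Φ` for a stable `Φ ≤ E[p]`).  The card's (β)-remark «`φ = ψ = 𝟙`: at `p = 2` both
Jordan–Hölder characters of `E[2]` are trivial» in kernel form:

* `smul_eq_self_of_natCard_eq_two` — a group of order `2` carries only the TRIVIAL action of any group acting by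
  automorphisms (`g • 0 = 0` and `g •` is injective);
* `exists_equivariant_addEquiv_of_natCard_eq_two` — two `Γ_K`-modules of order `2` are EQUIVARIANTLY isomorphic
  (cyclic of the same prime order, Mathlib `addEquivOfAddCyclicCardEq`; equivariance from triviality);
* `natCard_quot_eq_two` — for a stable LINE `Φ ≤ E[2]` (`#Φ = 2`) the quotient `E[2]/Φ` has order `2` (`#E[2] = 4`);
* **`finite_residual_quot_iff_sub_of_line_two`** — hence `R_w^Σ(K_∞, E[2]/Φ)` is finite iff `R_w^Σ(K_∞, Φ)` is
  (tree `finite_residualSelmer_iff_of_addEquiv` along the equivariant isomorphism), and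
* **`greenbergStrictSelmerDual_finite_torsion_mu_of_residual_line_two`** — B2 for the Greenberg (strict at `w`, relaxed at
  `w̄`) dual of `E[2^∞]` over ANY `ℤ₂`-extension `K_∞/K` in which `w` is finitely decomposed, from the SINGLE input
  «`R_w^Σ(K_∞, Φ)` finite» — for the trivial module `Φ ≅ 𝔽₂` this is «the maximal abelian pro-`2` extension of `K_∞`
  unramified outside `Σ ∪ {w̄}` and split at `w` has finitely many quadratic subextensions», i.e. classical Iwasawa theory of
  the Greenberg field `K` (Ferrero–Washington + Leopoldt/Brumer on the cyclotomic line; NOT stated or proved here).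

HONEST FRAMING.  Pure group theory + composition of tree theorems; no named fact, no definition, no `sorry`; nothing about any
particular curve is asserted; BSD is not proved by any of this.  PARTITION (D-0054): none — RANK axis S3 × X5@2 stratum (β).

References: F. Castella, G. Grossi, J. Lee, C. Skinner, Invent. Math. 227 (2022) §1.4 [CastellaGrossiLeeSkinner2022];
R. Greenberg, V. Vatsal, Invent. Math. 142 (2000) §2 [GreenbergVatsal2000]; R. Greenberg, LNM 1716 (1999) §1 [GreenbergLNM1716].
-/

set_option linter.dupNamespace false
set_option autoImplicit false

noncomputable section

open scoped Classical

namespace Summit.BirchSwinnertonDyer.BirchSwinnertonDyer.Theorems.TwoAdicGreenbergCotorsion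

open NumberField IsDedekindDomain Field WeierstrassCurve
open Literature.NumberTheory.EllipticCurves Literature.NumberTheory.EllipticCurves.GreenbergSelmer
  Literature.NumberTheory.EllipticCurves.GreenbergVatsal2000
  Summit.BirchSwinnertonDyer.Rank1Residual.X11b Summit.BirchSwinnertonDyer.Rank1Residual.X11b.AcSelmer
  Summit.BirchSwinnertonDyer.Rank1Residual.X2.ResidualDevissageModules
  Summit.BirchSwinnertonDyer.BirchSwinnertonDyer.Theorems.UniversalToricDescentResidualSelmer

/-! ## §1 Groups of order two carry only the trivial action -/

section OrderTwo

variable {G : Type*} [Group G] {M : Type*} [AddCommGroup M] [DistribMulAction G M]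

/-- **A group of order `2` carries only the trivial action** of a group acting by (additive) automorphisms: `g • 0 = 0`,
and the unique non-zero element is fixed because `g • ·` is injective. [folklore] -/
theorem smul_eq_self_of_natCard_eq_two (hM : Nat.card M = 2) (g : G) (m : M) : g • m = m := by
  by_cases hm : m = 0
  · rw [hm, smul_zero]
  · -- `M = {0, m}`: the non-zero element `g • m` must be `m`
    have hgm : g • m ≠ 0 := fun h ↦ hm (smul_eq_zero_iff_eq g |>.mp h)
    obtain ⟨y, hy, huniq⟩ := (Nat.card_eq_two_iff' (0 : M)).mp hM
    rw [huniq (g • m) hgm, huniq m hm]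

variable {M' : Type*} [AddCommGroup M'] [DistribMulAction G M']

/-- **Two `G`-modules of order `2` are EQUIVARIANTLY isomorphic** (cyclic groups of the same prime order are isomorphic,
Mathlib `addEquivOfAddCyclicCardEq`; both actions are trivial). [folklore] -/
theorem exists_equivariant_addEquiv_of_natCard_eq_two (hM : Nat.card M = 2) (hM' : Nat.card M' = 2) :
    ∃ ψ : M ≃+ M', ∀ (g : G) (m : M), ψ (g • m) = g • ψ m := by
  haveI : Fact (Nat.Prime 2) := ⟨Nat.prime_two⟩
  haveI : IsAddCyclic M := isAddCyclic_of_prime_card hM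
  haveI : IsAddCyclic M' := isAddCyclic_of_prime_card hM'
  refine ⟨addEquivOfAddCyclicCardEq (hM.trans hM'.symm), fun g m ↦ ?_⟩
  rw [smul_eq_self_of_natCard_eq_two hM, smul_eq_self_of_natCard_eq_two hM']

end OrderTwo

/-! ## §2 At `p = 2`: the quotient by a stable line has order two, and one residual input suffices -/

variable {K : Type} [Field K] [NumberField K] (V : WeierstrassCurve K) [V.IsElliptic] (κ : ZpExtension K 2)

/-- For a stable LINE `Φ ≤ E[2]` (`#Φ = 2`) the quotient `E[2]/Φ` has order `2` (`#E[2] = 4`, tree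
`natCard_geomTorsion_prime_eq_sq`). [cite: SilvermanAEC2009, III.6.4(b)] -/
theorem natCard_quot_eq_two (Φ : StableSubgroup (absoluteGaloisGroup K) (V.geomTorsion (2 : ℤ)))
    (hΦ : Nat.card Φ.Sub = 2) : Nat.card Φ.Quot = 2 := by
  have h4 : Nat.card (V.geomTorsion ((2 : ℕ) : ℤ)) = 2 ^ 2 := V.natCard_geomTorsion_prime_eq_sq Nat.prime_two
  have h := Φ.natCard_eq_mul
  rw [show ((2 : ℕ) : ℤ) = 2 from rfl] at h4
  rw [h4, hΦ] at h
  omega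

/-- **One residual input suffices at `2`**: for a stable line `Φ ≤ E[2]`, the residual Castella Selmer group of `E[2]/Φ` is
finite iff that of `Φ` is (both modules are `𝔽₂` with the trivial action; tree `finite_residualSelmer_iff_of_addEquiv`).
[cite: GreenbergVatsal2000, §2 p. 26] -/
theorem finite_residual_quot_iff_sub_of_line_two (H : Subgroup (absoluteGaloisGroup K)) [H.Normal]
    (w : HeightOneSpectrum (𝓞 K)) (S : Set (HeightOneSpectrum (𝓞 K)))
    (Φ : StableSubgroup (absoluteGaloisGroup K) (V.geomTorsion (2 : ℤ))) (hΦ : Nat.card Φ.Sub = 2) :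
    (datumStrictSelmer H Φ.Quot 2 (AcSelmer.bdpData Φ.Quot 2 w) S :
        Set (Literature.NumberTheory.EllipticCurves.subgroupH1 H Φ.Quot)).Finite ↔
      (datumStrictSelmer H Φ.Sub 2 (AcSelmer.bdpData Φ.Sub 2 w) S :
        Set (Literature.NumberTheory.EllipticCurves.subgroupH1 H Φ.Sub)).Finite := by
  obtain ⟨ψ, hψ⟩ := exists_equivariant_addEquiv_of_natCard_eq_two (G := absoluteGaloisGroup K)
    (natCard_quot_eq_two V Φ hΦ) hΦ
  exact finite_residualSelmer_iff_of_addEquiv H 2 w S ψ hψ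

/-- **B2 at `p = 2` from ONE `GL(1)` input.**  For an elliptic curve `V/K`, ANY `ℤ₂`-extension `κ` of `K`, a place `w ∣ 2` with
`D_w ⊄ ker κ`, a set `Σ` containing every bad place prime to `2`, a `Γ_K`-stable LINE `Φ ≤ E[2]` whose residual Castella Selmer
group `R_w^Σ(K_∞, Φ)` is finite, and a topological generator `γ`: every Pontryagin-dual datum `D` of the Greenberg (strict at `w`,
relaxed elsewhere above `2`) Selmer group of `E[2^∞]` over `K_∞` has `D.X` finitely generated over `Λ`, `Λ`-torsion, `μ = 0`.
(For the kato-determinant line: `V = W.baseChange K`, `κ` cyclotomic, `Φ` = the line of the rational `2`-torsion point.)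
[cite: CastellaGrossiLeeSkinner2022, §1.4 Props. 17–18] [cite: GreenbergLNM1716, §1 p. 60] -/
theorem greenbergStrictSelmerDual_finite_torsion_mu_of_residual_line_two
    {γ : absoluteGaloisGroup K} (hγ : κ.IsTopGenerator γ)
    {w : HeightOneSpectrum (𝓞 K)} (hw : ((2 : ℕ) : 𝓞 K) ∈ w.asIdeal) (hwdec : ¬ (decomp w ≤ κ.kerSubgroup))
    {S : Set (HeightOneSpectrum (𝓞 K))}
    (hS : ∀ v : HeightOneSpectrum (𝓞 K), v ∉ S → ((2 : ℕ) : 𝓞 K) ∉ v.asIdeal → V.HasGoodReductionAt v)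
    (Φ : StableSubgroup (absoluteGaloisGroup K) (V.geomTorsion (2 : ℤ))) (hΦ2 : Nat.card Φ.Sub = 2)
    (hΦ : (datumStrictSelmer κ.kerSubgroup Φ.Sub 2 (AcSelmer.bdpData Φ.Sub 2 w) S :
      Set (Literature.NumberTheory.EllipticCurves.subgroupH1 κ.kerSubgroup Φ.Sub)).Finite)
    (D : V.GreenbergStrictSelmerDualData κ γ (AcSelmer.bdpData _ 2 w)) :
    Module.Finite (IwasawaAlgebra 2) D.X ∧ Module.IsTorsion (IwasawaAlgebra 2) D.X ∧ muInvariant 2 D.X = 0 :=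
  greenbergStrictSelmerDual_finite_torsion_mu_of_residual V κ hγ hw hwdec hS Φ hΦ
    ((finite_residual_quot_iff_sub_of_line_two V κ.kerSubgroup w S Φ hΦ2).mpr hΦ) D

end Summit.BirchSwinnertonDyer.BirchSwinnertonDyer.Theorems.TwoAdicGreenbergCotorsion

end
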